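import Summits.AnomalousDissipation.AnomalousDissipation.Theorems.ScalarAnomalySteadySourceFormal.Negative.ShearBand

/-!
# Negative knowledge for the crux `ScalarAnomalySteadySourceFormal` (stmt-AnomalousDissipation-0448), X-a:
# Wiener-class stirring — flux modes of a velocity with absolutely summable Fourier series

Certified copy of §12.1 of the cdisprove work file.  The band-limited no-gos (§9–§10) are extended
to velocity fields with INFINITE Fourier support but absolutely summable amplitudes (the Wiener
algebra `A(𝕋^d)`; every `H^{s}`, `s > d/2 + …`, field): a slice is given by a coefficient function
`C : ℤ^d → ℂ^d` with `‖C q‖ ≤ a q`, `∑ a < ∞`, conjugate symmetry `C(-q) = conj C(q)` (reality) and,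
downstream, transversality.  Here:

* `wienComp C j x = ∑' q e_q(x) C_{q,j}` (absolutely convergent, continuous, real under the symmetry),
  the real field `wienField C` with `(wienField C x j : ℂ) = wienComp C j x`;
* `mFourierCoeff_mul_wienField` — **flux modes**: for integrable real `θ`,
  `𝓕(θ · (wienField C)_j)(p) = ∑' q C_{q,j} 𝓕θ(p-q)` (pointwise series, `integral_tsum`, shift rule);
* `wTransportMode C Y p = 2πi ∑' q (p·C_q) Y(p-q)` and `sum_flux_eq_wTransportMode`:
  `∑ⱼ 2πi pⱼ 𝓕(θ (wienField C)_j)(p) = wTransportMode C (𝓕θ) p`.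

Supports stmt-AnomalousDissipation-0448 (the Wiener-class no-go, files `Wien*`).
-/

set_option linter.dupNamespace false

noncomputable section

open scoped BigOperators Topology ENNReal NNReal InnerProductSpace ContDiff
open Filter Set Function MeasureTheory UnitAddTorus Complex

namespace Summit.AnomalousDissipation.AnomalousDissipation.Theorems.ScalarAnomalySteadySourceFormal.Negative

open Literature.Analysis
open Literature.Analysis.FunctionSpaces Literature.Analysis.FunctionSpaces.Torus
open Literature.Analysis.FluidPDE Literature.Analysis.FluidPDE.Torus

variable {d : Type*} [Fintype d]

section WienerField

variable {C : (d → ℤ) → EuclideanSpace ℂ d} {a : (d → ℤ) → ℝ}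

/-- `‖e_q(x) C_{q,j}‖ ≤ ‖C q‖`. [folklore] -/
theorem norm_mFourier_mul_apply_le (C : (d → ℤ) → EuclideanSpace ℂ d) (q : d → ℤ) (x : UnitAddTorus d) (j : d) :
    ‖mFourier q x * C q j‖ ≤ ‖C q‖ := by
  rw [norm_mul]
  calc ‖mFourier q x‖ * ‖C q j‖ ≤ 1 * ‖C q‖ := by
        gcongr
        · exact ((mFourier q).norm_coe_le_norm x).trans_eq mFourier_norm
        · exact PiLp.norm_apply_le (C q) j
    _ = ‖C q‖ := one_mul _

/-- The component series is absolutely summable. [folklore] -/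
theorem summable_mFourier_mul_apply (hs : Summable fun q => ‖C q‖) (x : UnitAddTorus d) (j : d) :
    Summable fun q => mFourier q x * C q j :=
  Summable.of_norm_bounded (g := fun q => ‖C q‖) hs fun q => norm_mFourier_mul_apply_le C q x j

/-- The complex components of a Wiener-class field: `w_j(x) = ∑' q e_q(x) C_{q,j}`. [folklore] -/
def wienComp (C : (d → ℤ) → EuclideanSpace ℂ d) (j : d) (x : UnitAddTorus d) : ℂ :=
  ∑' q, mFourier q x * C q j

/-- The components are continuous (uniform convergence). [folklore] -/
theorem continuous_wienComp (hs : Summable fun q => ‖C q‖) (j : d) : Continuous (wienComp C j) :=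
  continuous_tsum (fun q => (mFourier q).continuous.mul continuous_const) hs fun q x => norm_mFourier_mul_apply_le C q x j

/-- Sup bound: `‖w_j(x)‖ ≤ ∑ ‖C q‖`. [folklore] -/
theorem norm_wienComp_le (hs : Summable fun q => ‖C q‖) (j : d) (x : UnitAddTorus d) :
    ‖wienComp C j x‖ ≤ ∑' q, ‖C q‖ :=
  (norm_tsum_le_tsum_norm (summable_mFourier_mul_apply hs x j).norm).trans
    (Summable.tsum_le_tsum (fun q => norm_mFourier_mul_apply_le C q x j) (summable_mFourier_mul_apply hs x j).norm hs)

/-- Under conjugate symmetry the components are real. [folklore] -/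
theorem conj_wienComp (hsymm : ∀ q, C (-q) = EuclideanSpace.conjVec (C q)) (j : d)
    (x : UnitAddTorus d) : (starRingEnd ℂ) (wienComp C j x) = wienComp C j x := by
  unfold wienComp
  rw [Complex.conj_tsum]  -- conj is continuous: `conj (∑' f) = ∑' conj f`
  · calc ∑' q, (starRingEnd ℂ) (mFourier q x * C q j) = ∑' q, mFourier (-q) x * C (-q) j := by
          refine tsum_congr fun q => ?_
          rw [map_mul, ← mFourier_neg, hsymm q, EuclideanSpace.conjVec_apply]
      _ = ∑' q, mFourier q x * C q j := (Equiv.neg (d → ℤ)).tsum_eq (fun q => mFourier q x * C q j)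

/-- **The real Wiener-class field** with coefficient function `C`. [folklore] -/
def wienField (C : (d → ℤ) → EuclideanSpace ℂ d) (x : UnitAddTorus d) : EuclideanSpace ℝ d :=
  WithLp.toLp 2 fun j => (wienComp C j x).re

/-- Components of the real field. [folklore] -/
theorem wienField_apply (C : (d → ℤ) → EuclideanSpace ℂ d) (x : UnitAddTorus d) (j : d) :
    wienField C x j = (wienComp C j x).re := rfl

/-- Under conjugate symmetry, `(wienField C x j : ℂ) = w_j(x)`. [folklore] -/
theorem coe_wienField_apply (hsymm : ∀ q, C (-q) = EuclideanSpace.conjVec (C q))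
    (x : UnitAddTorus d) (j : d) : ((wienField C x j : ℝ) : ℂ) = wienComp C j x := by
  rw [wienField_apply]
  exact ((Complex.conj_eq_iff_re.1 (conj_wienComp hsymm j x)).symm).symm

/-- The real field is continuous. [folklore] -/
theorem continuous_wienField (hs : Summable fun q => ‖C q‖) : Continuous (wienField C) := by
  refine (PiLp.continuous_toLp 2 _).comp (continuous_pi fun j => ?_)
  exact Complex.continuous_re.comp (continuous_wienComp hs j)

/-- Sup bound for the real field: `‖wienField C x‖ ≤ #d · ∑ ‖C q‖`-type, componentwise `|·| ≤ ∑‖C q‖`. [folklore] -/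
theorem abs_wienField_apply_le (hs : Summable fun q => ‖C q‖) (x : UnitAddTorus d) (j : d) :
    |wienField C x j| ≤ ∑' q, ‖C q‖ :=
  (Complex.abs_re_le_norm _).trans (norm_wienComp_le hs j x)

end WienerField

section FluxModes

variable {C : (d → ℤ) → EuclideanSpace ℂ d}

/-- **Flux modes of a Wiener-class field**: `𝓕(θ w_j)(p) = ∑' q C_{q,j} 𝓕θ(p-q)` for integrable real
`θ` (pointwise series, `integral_tsum`, shift rule). [folklore] -/
theorem mFourierCoeff_mul_wienField {θs : UnitAddTorus d → ℝ} (hθs : Integrable θs volume)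
    (hs : Summable fun q => ‖C q‖) (hsymm : ∀ q, C (-q) = EuclideanSpace.conjVec (C q)) (j : d) (p : d → ℤ) :
    mFourierCoeff (fun x => ((θs x * wienField C x j : ℝ) : ℂ)) p =
      ∑' q, C q j * mFourierCoeff (fun x => (θs x : ℂ)) (p - q) := by
  -- pointwise: the integrand of the coefficient as a series
  have hpt : ∀ x, mFourier (-p) x * ((θs x * wienField C x j : ℝ) : ℂ) =
      ∑' q, C q j * (mFourier (-p) x * (mFourier q x * (θs x : ℂ))) := by
    intro x
    push_cast
    rw [coe_wienField_apply hsymm, wienComp, ← tsum_mul_left, ← tsum_mul_left]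
    exact tsum_congr fun q => by ring
  -- each term is integrable, with summable `L¹` norms
  have hterm : ∀ q, Integrable (fun x => C q j * (mFourier (-p) x * (mFourier q x * (θs x : ℂ)))) volume := by
    intro q
    refine Integrable.const_mul ?_ _
    have h1 : Integrable (fun x => mFourier q x * (θs x : ℂ)) volume := integrable_mFourier_mul_ofReal hθs q
    exact h1.bdd_mul (c := 1) (mFourier (-p)).continuous.aestronglyMeasurable
      (Eventually.of_forall fun x => ((mFourier (-p)).norm_coe_le_norm x).trans_eq mFourier_norm)
  have hnorm : ∀ q x, ‖C q j * (mFourier (-p) x * (mFourier q x * (θs x : ℂ)))‖ ≤ ‖C q‖ * ‖θs x‖ := by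
    intro q x
    rw [norm_mul, norm_mul, norm_mul, Complex.norm_real]
    have e1 : ‖mFourier (-p) x‖ ≤ 1 := ((mFourier (-p)).norm_coe_le_norm x).trans_eq mFourier_norm
    have e2 : ‖mFourier q x‖ ≤ 1 := ((mFourier q).norm_coe_le_norm x).trans_eq mFourier_norm
    have e3 : ‖C q j‖ ≤ ‖C q‖ := PiLp.norm_apply_le (C q) j
    calc ‖C q j‖ * (‖mFourier (-p) x‖ * (‖mFourier q x‖ * ‖θs x‖)) ≤ ‖C q‖ * (1 * (1 * ‖θs x‖)) := by
          gcongr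
      _ = ‖C q‖ * ‖θs x‖ := by ring
  have hsumI : ∑' q, ∫⁻ x, ‖C q j * (mFourier (-p) x * (mFourier q x * (θs x : ℂ)))‖ₑ ≠ ⊤ := by
    have hle : ∀ q, ∫⁻ x, ‖C q j * (mFourier (-p) x * (mFourier q x * (θs x : ℂ)))‖ₑ ≤
        ENNReal.ofReal (‖C q‖) * ∫⁻ x, ‖θs x‖ₑ := by
      intro q
      rw [← lintegral_const_mul' _ _ ENNReal.ofReal_ne_top]
      refine lintegral_mono fun x => ?_
      rw [← ofReal_norm, ← ofReal_norm, ← ENNReal.ofReal_mul (norm_nonneg _)]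
      exact ENNReal.ofReal_le_ofReal (hnorm q x)
    refine ne_top_of_le_ne_top ?_ (ENNReal.tsum_le_tsum hle)
    rw [ENNReal.tsum_mul_right]
    refine ENNReal.mul_ne_top ?_ hθs.2.ne
    rw [← ENNReal.ofReal_tsum_of_nonneg (fun q => norm_nonneg _) hs]
    exact ENNReal.ofReal_ne_top
  rw [FunctionSpaces.Torus.mFourierCoeff_eq_integral_volume]
  simp only [smul_eq_mul]
  rw [show (fun x => mFourier (-p) x * ((θs x * wienField C x j : ℝ) : ℂ)) =
      fun x => ∑' q, C q j * (mFourier (-p) x * (mFourier q x * (θs x : ℂ))) from funext hpt,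
    integral_tsum (fun q => (hterm q).aestronglyMeasurable) hsumI]
  refine tsum_congr fun q => ?_
  rw [integral_const_mul]
  congr 1
  rw [← mFourierCoeff_mFourier_mul (fun x => (θs x : ℂ)) q p, FunctionSpaces.Torus.mFourierCoeff_eq_integral_volume]
  simp only [smul_eq_mul]

/-- **The Wiener-class transport symbol**: `N_p(Y) = 2πi ∑' q (p·C_q) Y(p-q)`. [folklore] -/
def wTransportMode (C : (d → ℤ) → EuclideanSpace ℂ d) (Y : (d → ℤ) → ℂ) (p : d → ℤ) : ℂ :=
  2 * Real.pi * I * ∑' q, zdot p (C q) * Y (p - q)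

/-- `‖p · w‖ ≤ (∑ⱼ |pⱼ|) ‖w‖`. [folklore] -/
theorem norm_zdot_le_sum (p : d → ℤ) (w : EuclideanSpace ℂ d) : ‖zdot p w‖ ≤ (∑ j, |(p j : ℝ)|) * ‖w‖ := by
  unfold zdot
  refine (norm_sum_le _ _).trans ?_
  rw [Finset.sum_mul]
  refine Finset.sum_le_sum fun j _ => ?_
  rw [norm_mul, Complex.norm_intCast]
  exact mul_le_mul_of_nonneg_left (PiLp.norm_apply_le w j) (abs_nonneg _)

/-- Summability of the transport series for bounded `Y`. [folklore] -/
theorem summable_zdot_mul (hs : Summable fun q => ‖C q‖) {Y : (d → ℤ) → ℂ} {B : ℝ} (hY : ∀ q, ‖Y q‖ ≤ B)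
    (p : d → ℤ) : Summable fun q => zdot p (C q) * Y (p - q) := by
  have hB : 0 ≤ B := (norm_nonneg _).trans (hY 0)
  refine Summable.of_norm_bounded (g := fun q => ((∑ j, |(p j : ℝ)|) * B) * ‖C q‖) (hs.mul_left _) fun q => ?_
  rw [norm_mul]
  calc ‖zdot p (C q)‖ * ‖Y (p - q)‖ ≤ ((∑ j, |(p j : ℝ)|) * ‖C q‖) * B :=
        mul_le_mul (norm_zdot_le_sum p (C q)) (hY _) (norm_nonneg _) (by positivity)
    _ = ((∑ j, |(p j : ℝ)|) * B) * ‖C q‖ := by ring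

/-- **Flux divergence in modes** for a Wiener-class field: `∑ⱼ 2πi pⱼ 𝓕(θ w_j)(p) = N_p(𝓕θ)`. [folklore] -/
theorem sum_flux_eq_wTransportMode {θs : UnitAddTorus d → ℝ} (hθs : Integrable θs volume)
    (hs : Summable fun q => ‖C q‖) (hsymm : ∀ q, C (-q) = EuclideanSpace.conjVec (C q)) (p : d → ℤ) :
    ∑ j, (2 * Real.pi * I * (p j)) * mFourierCoeff (fun x => ((θs x * wienField C x j : ℝ) : ℂ)) p =
      wTransportMode C (fun q => mFourierCoeff (fun x => (θs x : ℂ)) q) p := by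
  set Y : (d → ℤ) → ℂ := fun q => mFourierCoeff (fun x => (θs x : ℂ)) q with hY
  -- the modes of an integrable function are bounded by its `L¹` norm
  have hYb : ∀ q, ‖Y q‖ ≤ ∫ x, ‖θs x‖ := by
    intro q
    simp only [hY]
    rw [FunctionSpaces.Torus.mFourierCoeff_eq_integral_volume]
    refine (norm_integral_le_integral_norm _).trans (integral_mono_of_nonneg (Eventually.of_forall fun _ => norm_nonneg _)
      hθs.norm (Eventually.of_forall fun x => ?_))
    show ‖mFourier (-q) x • (θs x : ℂ)‖ ≤ ‖θs x‖
    rw [norm_smul, Complex.norm_real]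
    calc ‖mFourier (-q) x‖ * ‖θs x‖ ≤ 1 * ‖θs x‖ := by
          gcongr; exact ((mFourier (-q)).norm_coe_le_norm x).trans_eq mFourier_norm
      _ = ‖θs x‖ := one_mul _
  have hsj : ∀ j, Summable fun q => C q j * Y (p - q) := by
    intro j
    refine Summable.of_norm_bounded (g := fun q => (∫ x, ‖θs x‖) * ‖C q‖) (hs.mul_left _) fun q => ?_
    rw [norm_mul]
    calc ‖C q j‖ * ‖Y (p - q)‖ ≤ ‖C q‖ * ∫ x, ‖θs x‖ := mul_le_mul (PiLp.norm_apply_le (C q) j) (hYb _) (norm_nonneg _) (norm_nonneg _)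
      _ = (∫ x, ‖θs x‖) * ‖C q‖ := mul_comm _ _
  have e0 : ∀ j, mFourierCoeff (fun x => ((θs x * wienField C x j : ℝ) : ℂ)) p = ∑' q, C q j * Y (p - q) :=
    fun j => mFourierCoeff_mul_wienField hθs hs hsymm j p
  simp_rw [e0]
  rw [wTransportMode]
  have e1 : ∀ j, (2 * Real.pi * I * (p j)) * ∑' q, C q j * Y (p - q) = ∑' q, (2 * Real.pi * I * (p j)) * (C q j * Y (p - q)) :=
    fun j => (tsum_mul_left).symm
  simp_rw [e1]
  rw [← Summable.tsum_finsetSum (fun j _ => (hsj j).mul_left _), ← tsum_mul_left]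
  refine tsum_congr fun q => ?_
  rw [zdot, Finset.sum_mul, Finset.mul_sum]
  exact Finset.sum_congr rfl fun j _ => by ring

end FluxModes

end Summit.AnomalousDissipation.AnomalousDissipation.Theorems.ScalarAnomalySteadySourceFormal.Negative
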